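import Literature.NumberTheory.EllipticCurves.KubertTate16883GaussianDescent
import Literature.NumberTheory.EllipticCurves.KubertTate289ShaFive
import HarnessLib

/-!
# Class-wide: the quadratic twist by `-4` of a Gaussian-tame Kubert–Tate curve `E_{m,n}` whose `ℚ`-box is full and
# whose `mn` has no prime factor `≡ 1 (mod 4)` has rank `0` and `t₅ = 0` — by the `5`-descent over `ℚ(i)`

PROOF-ONLY file (theorems only, no definition, no named fact, no `sorry`), topic `NumberTheory/EllipticCurves`; the
class-wide form of the instance `KubertTate16883GaussianDescent` (`(m, n) = (168, 83)`).  Setting: `E = E_{m,n} =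
[n-m, -mn, -mn², 0, 0]` over `ℚ` (`m, n ∈ ℤ`), `K = ℚ(i) = ℚ(ζ₄)` (any `K` with `IsCyclotomicExtension {4} ℚ K`).
Hypotheses (all decidable per curve):

* Gaussian tameness: `5 ∤ Δ`, every bad `ℓ` has `ℓ ≢ 1 (mod 5)` and (`ℓ ≡ 4 (mod 5) ⇒ ℓ ≡ 1 (mod 4)`);
* `mn` has no prime factor `≡ 1 (mod 4)` (every `ℓ ∣ mn` is `2` or `≡ 3 (mod 4)`: ONE place of `ℚ(i)` above each);
* a rational point `(x, y)` with `x ∉ {0, mn}` and a good prime `q ≤ 11`, `q ≠ 5` (so `25·(x,y) ≠ O`, tree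
  `KubertTateFiveTorsion.twentyfive_nsmul_ne_zero`);
* the `ℚ`-box is full: `ω(mn) ≤ rank E(ℚ) + 1` (e.g. from the tree's `ℚ`-instances `KubertTate…ShaFive.mordellWeilRank_eq`).

Then the set `S` of places of `ℚ(i)` above the primes of `mn` has `#S ≤ ω(mn) ≤ rank E(ℚ) + 1 ≤ rank E(ℚ(i)) + 1`, so the
`ℚ(i)`-box `#Sel^{φ̂}(E'/ℚ(i)) ≤ 5^{#S}` is FULL (`#(E(K)/5E(K)) = 5^{rank E(K)} · #E(K)[5] ≥ 5^{#S}`), and the tree's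
`KubertTateMuDescentNF.shaCorank_five_eq_zero_of_le` / `mordellWeilRank_succ_le` give:

* `shaCorank_five_baseChange_eq_zero` — **`t₅(E_{m,n} ⊗ ℚ(i)) = 0`**;
* `mordellWeilRank_baseChange_eq` — `rank E_{m,n}(ℚ(i)) = rank E_{m,n}(ℚ)` (and `= ω(mn) - 1`);
* `mordellWeilRank_twist_eq_zero` — **`rank E_{m,n}^{(-4)}(ℚ) = 0`**; `shaCorank_five_twist_eq_zero` —
  **`t₅(E_{m,n}^{(-4)}/ℚ) = 0`**; `shaCorank_five_eq_zero` — `t₅(E_{m,n}/ℚ) = 0` (again, now via `ℚ(i)`);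
* §4 the instance `(m, n) = (28, 9)` (`E_{28/9} = [-19, -252, -2268, 0, 0]`, rank `2`, bad primes `2, 3, 7, 2069`,
  `2069 ≡ 4 (mod 5)`, `≡ 1 (mod 4)`): `rank E_{28/9}^{(-4)}(ℚ) = 0`, `t₅(E_{28/9}^{(-4)}) = 0`.

The twists `E_{m,n}^{(-4)} ≅ E_{m,n}^{(-1)}` have NO rational `5`-torsion point; rank `0` and `t₅ = 0` for them are obtained
with no `L`-function, no `p`-adic and no conjectural input (descent over `ℚ(i)` + `Sel₅(E/ℚ(i)) = Sel₅(E/ℚ) ⊕ Sel₅(E^{(-4)}/ℚ)`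
in corank form: the tree's `selmerCorank_baseChange_quadratic_holds`, `mordellWeilRank_baseChange_quadratic_holds`).

## References

* [SilvermanAEC2009] J. H. Silverman, *AEC*, 2nd ed., Thm. X.4.2, Prop. X.4.9, Exercise 10.1(c), Exercise 10.16.
* [Fisher2001FiveSevenDescent] T. Fisher, JEMS 3 (2001), §§1–2.
* [IrelandRosen1982] K. Ireland, M. Rosen, *A Classical Introduction to Modern Number Theory*, Ch. 9 §7 Lemmas 3–5.
* [Dokchitser2013ParityNotes] T. Dokchitser, Notes on the parity conjecture (2013), §4.
-/

noncomputable section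

open scoped Classical NNReal NumberField AddSubgroup
open WeierstrassCurve WeierstrassCurve.Isogeny Field IsDedekindDomain Ideal
open Literature.NumberTheory.EllipticCurves Literature.NumberTheory.EllipticCurves.KubertTateVelu
  Literature.NumberTheory.EllipticCurves.KubertTateMuDescentNF Literature.NumberTheory.NumberFields
  Literature.NumberTheory.EllipticCurves.KubertTate16883GaussianDescent

namespace Literature.NumberTheory.EllipticCurves

namespace KubertTateGaussianTwist

variable {K : Type} [Field K] [NumberField K] [IsCyclotomicExtension {4} ℚ K]
variable (m n : ℤ) [hEQ : (kubertTateFive (m : ℚ) (n : ℚ)).IsElliptic]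

/-! ## §1 The curve over `ℚ(i)` and the reference point -/

omit [IsCyclotomicExtension {4} ℚ K] in
/-- `E_{m,n} ⊗ ℚ(i)` is elliptic. [cite: Kubert1976, Table 3 (N = 5)] -/
theorem isElliptic_base : (kubertTateFive (m : K) (n : K)).IsElliptic :=
  KubertTateMuDescentNF.baseChange_eq (K := ℚ) m n K ▸ isElliptic_baseChange (kubertTateFive (m : ℚ) (n : ℚ)) K

omit [IsCyclotomicExtension {4} ℚ K] in
/-- A rational point of `E_{m,n}` read over `K`. [cite: SilvermanAEC2009, VIII.§1] -/
theorem nonsingular_cast {x y : ℚ} (hxy : (kubertTateFive (m : ℚ) (n : ℚ)).toAffine.Nonsingular x y) :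
    (kubertTateFive (m : K) (n : K)).toAffine.Nonsingular (x : K) (y : K) := by
  haveI := isElliptic_base (K := K) m n
  have heq := (KubertTateMuDescentNF.equation_iff_base (K := ℚ) m n x y).mp hxy.left
  rw [← Affine.equation_iff_nonsingular, KubertTateMuDescentNF.equation_iff_base (K := K) m n]
  have h := congrArg (fun t : ℚ ↦ (t : K)) heq
  push_cast at h ⊢
  linear_combination h

/-- Transport of `k • P = 0` for an affine point along an equality of curves (instances are propositions). [folklore] -/
private theorem nsmul_some_eq_zero_of_eq {F : Type*} [Field F] {V V' : WeierstrassCurve F} (e : V = V') {x y : F}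
    (h : V.toAffine.Nonsingular x y) (h' : V'.toAffine.Nonsingular x y) (k : ℕ)
    (h0 : k • (Affine.Point.some x y h : V.toAffine.Point) = 0) :
    k • (Affine.Point.some x y h' : V'.toAffine.Point) = 0 := by
  subst e; exact h0

/-- Two affine points with equal coordinates are equal (proof-irrelevant form). [folklore] -/
private theorem some_eq_some_of_eq {R : Type*} [CommRing R] {V : WeierstrassCurve R}
    {x y x' y' : R} (hx : x = x') (hy : y = y') (h : V.toAffine.Nonsingular x y)
    (h' : V.toAffine.Nonsingular x' y') : Affine.Point.some x y h = Affine.Point.some x' y' h' := by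
  subst hx hy; rfl

omit [IsCyclotomicExtension {4} ℚ K] in
/-- **`25·P ≠ O` in `E(\overline{ℚ(i)})`** for a rational point `P = (x, y)` with `x ∉ {0, mn}` when some prime
`q ≤ 11`, `q ≠ 5`, is of good reduction (`E(ℚ)[25] = ⟨T⟩`, tree `KubertTateFiveTorsion.twentyfive_nsmul_ne_zero`;
transported along `E(ℚ) ↪ E(K) ↪ E(K̄)`). [cite: SilvermanAEC2009, VII.3.1(b) and VIII.§1] -/
theorem twentyfive_zsmul_toGeomPoints_cast_ne_zero {x y : ℚ}
    (hxy : (kubertTateFive (m : ℚ) (n : ℚ)).toAffine.Nonsingular x y) (hx0 : x ≠ 0) (hx : x ≠ m * n)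
    (q : ℕ) [Fact q.Prime] (hq5 : q ≠ 5) (hq11 : 2 * q + 1 < 25) (hqΔ : ¬ (q : ℤ) ∣ (kubertTateFive m n).Δ) :
    ((25 : ℕ) : ℤ) • toGeomPoints (kubertTateFive (m : K) (n : K))
      (Affine.Point.some (x : K) (y : K) (nonsingular_cast m n hxy)) ≠ 0 := by
  intro h0
  rw [natCast_zsmul] at h0
  have h1 : (25 : ℕ) • (Affine.Point.some (x : K) (y : K) (nonsingular_cast m n hxy) :
      (kubertTateFive (m : K) (n : K)).toAffine.Point) = 0 := by
    apply toGeomPoints_injective (kubertTateFive (m : K) (n : K))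
    rw [(toGeomPoints (kubertTateFive (m : K) (n : K))).map_nsmul, h0,
      (toGeomPoints (kubertTateFive (m : K) (n : K))).map_zero]
  have eC : (kubertTateFive (m : ℚ) (n : ℚ)).baseChange K = kubertTateFive (m : K) (n : K) :=
    KubertTateMuDescentNF.baseChange_eq (K := ℚ) m n K
  have hK' : ((kubertTateFive (m : ℚ) (n : ℚ)).baseChange K).toAffine.Nonsingular (x : K) (y : K) := by
    rw [eC]; exact nonsingular_cast m n hxy
  have h2 := nsmul_some_eq_zero_of_eq eC.symm (nonsingular_cast m n hxy) hK' 25 h1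
  let ι : (kubertTateFive (m : ℚ) (n : ℚ)).toAffine.Point →+
      ((kubertTateFive (m : ℚ) (n : ℚ)).baseChange K).toAffine.Point :=
    Affine.Point.map (W' := kubertTateFive (m : ℚ) (n : ℚ)) (Algebra.ofId ℚ K)
  have hιinj : Function.Injective ι :=
    Affine.Point.map_injective (W' := kubertTateFive (m : ℚ) (n : ℚ)) (f := Algebra.ofId ℚ K)
  have hxK : (Algebra.ofId ℚ K) x = (x : K) := rfl
  have hyK : (Algebra.ofId ℚ K) y = (y : K) := rfl
  have eι : ι (Affine.Point.some x y hxy) = Affine.Point.some (x : K) (y : K) hK' := by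
    change Affine.Point.map (W' := kubertTateFive (m : ℚ) (n : ℚ)) (Algebra.ofId ℚ K) (Affine.Point.some x y hxy) = _
    rw [Affine.Point.map_some]
    exact some_eq_some_of_eq hxK hyK _ _
  have h3 : (25 : ℕ) • (Affine.Point.some x y hxy : (kubertTateFive (m : ℚ) (n : ℚ)).toAffine.Point) = 0 := by
    apply hιinj
    rw [ι.map_nsmul, eι, h2, ι.map_zero]
  have hinst : (instDecidableEqRat : DecidableEq ℚ) = fun a b ↦ Classical.propDecidable _ := Subsingleton.elim _ _
  rw [hinst] at h3
  exact KubertTateFiveTorsion.twentyfive_nsmul_ne_zero m n q hq5 hq11 hqΔ (h := hxy) hx0 hx h3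

/-! ## §2 The places of `ℚ(i)` above the primes of `mn` (none `≡ 1 (mod 4)`) -/

omit [IsCyclotomicExtension {4} ℚ K] in
/-- Every rational prime lies under some finite place. [cite: IrelandRosen1982, Ch. 9 §7] -/
private theorem exists_natCast_mem_asIdeal {ℓ : ℕ} (hℓ : ℓ.Prime) :
    ∃ v : HeightOneSpectrum (𝓞 K), (ℓ : 𝓞 K) ∈ v.asIdeal := by
  haveI := Fact.mk hℓ
  obtain ⟨⟨P, hP, hPover⟩⟩ := (span {(ℓ : ℤ)}).nonempty_primesOver (S := 𝓞 K)
  have hℓZ : (ℓ : ℤ) ≠ 0 := Int.natCast_ne_zero.mpr hℓ.ne_zero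
  have hP0 : P ≠ ⊥ := Ideal.ne_bot_of_liesOver_of_ne_bot (p := span {(ℓ : ℤ)}) (by simpa using hℓZ) P
  refine ⟨⟨P, hP, hP0⟩, ?_⟩
  have h : ((ℓ : ℤ) : ℤ) ∈ span {(ℓ : ℤ)} := mem_span_singleton_self _
  rw [mem_of_liesOver P] at h
  simpa using h

omit [NumberField K] [IsCyclotomicExtension {4} ℚ K] in
/-- A finite place containing a rational prime `ℓ` and an integer `z` contains `gcd`: if `ℓ ∤ z` then `1 ∈ v` — so `ℓ ∣ z`.
[folklore] -/
private theorem natPrime_dvd_of_mem (v : HeightOneSpectrum (𝓞 K)) {ℓ : ℕ} (hℓ : ℓ.Prime)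
    (hℓv : (ℓ : 𝓞 K) ∈ v.asIdeal) {z : ℤ} (hzv : ((z : ℤ) : 𝓞 K) ∈ v.asIdeal) : (ℓ : ℤ) ∣ z := by
  by_contra hnd
  have hnd' : ¬ ℓ ∣ z.natAbs := fun h ↦ hnd (Int.natCast_dvd.mpr h)
  have hcop : IsCoprime (ℓ : ℤ) z := by
    rw [Int.isCoprime_iff_gcd_eq_one, Int.gcd_eq_natAbs]
    simpa using (Nat.Prime.coprime_iff_not_dvd hℓ).mpr hnd'
  obtain ⟨a, b, hab⟩ := hcop
  apply v.isPrime.ne_top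
  rw [Ideal.eq_top_iff_one]
  have h1 : ((a * ℓ + b * z : ℤ) : 𝓞 K) = 1 := by rw [hab]; norm_num
  rw [← h1]
  push_cast
  exact v.asIdeal.add_mem (v.asIdeal.mul_mem_left _ (by exact_mod_cast hℓv)) (v.asIdeal.mul_mem_left _ hzv)

omit hEQ in
/-- **A supporting set of places with `#S ≤ ω(mn)`** when every prime factor of `mn` is `2` or `≡ 3 (mod 4)` (exactly one
place of `ℤ[i]` above each: `KubertTate16883GaussianDescent.eq_of_two_mem`, `eq_of_natCast_mem_of_mod_four_eq_three`).
[cite: IrelandRosen1982, Ch. 9 §7 Lemmas 3–5] -/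
theorem exists_support (hm : m ≠ 0) (hn : n ≠ 0)
    (hω : ∀ ℓ ∈ (m * n).natAbs.primeFactors, ℓ = 2 ∨ ℓ % 4 = 3) :
    ∃ S : Finset (HeightOneSpectrum (𝓞 K)), S.card ≤ (m * n).natAbs.primeFactors.card ∧
      ∀ v : HeightOneSpectrum (𝓞 K), v ∉ S → ((m : ℤ) : 𝓞 K) ∉ v.asIdeal ∧ ((n : ℤ) : 𝓞 K) ∉ v.asIdeal := by
  have hch : ∀ ℓ : (m * n).natAbs.primeFactors, ∃ v : HeightOneSpectrum (𝓞 K), ((ℓ : ℕ) : 𝓞 K) ∈ v.asIdeal :=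
    fun ℓ ↦ exists_natCast_mem_asIdeal (K := K) (Nat.prime_of_mem_primeFactors ℓ.2)
  choose pl hpl using hch
  refine ⟨Finset.univ.image pl, ?_, fun v hv ↦ ?_⟩
  · calc (Finset.univ.image pl).card ≤ (Finset.univ : Finset ((m * n).natAbs.primeFactors)).card :=
          Finset.card_image_le
      _ = (m * n).natAbs.primeFactors.card := by simp
  · have hmn0 : (m * n).natAbs ≠ 0 := Int.natAbs_ne_zero.mpr (mul_ne_zero hm hn)
    -- a place containing a divisor `z ≠ 0` of `mn` is one of the chosen places
    have key : ∀ z : ℤ, z ∣ m * n → ((z : ℤ) : 𝓞 K) ∈ v.asIdeal → False := by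
      intro z hz hzv
      obtain ⟨ℓ, hℓ, hℓv⟩ := KubertTateVelu.exists_nat_prime_mem_asIdeal v
      have hℓz : (ℓ : ℤ) ∣ z := natPrime_dvd_of_mem v hℓ hℓv hzv
      have hℓmn : ℓ ∈ (m * n).natAbs.primeFactors := by
        rw [Nat.mem_primeFactors]
        exact ⟨hℓ, Int.natCast_dvd.mp (hℓz.trans hz), hmn0⟩
      have hv' : v = pl ⟨ℓ, hℓmn⟩ := by
        have hplℓ : ((ℓ : ℕ) : 𝓞 K) ∈ (pl ⟨ℓ, hℓmn⟩).asIdeal := hpl ⟨ℓ, hℓmn⟩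
        rcases hω ℓ hℓmn with h2 | h3
        · subst h2
          exact eq_of_two_mem (by exact_mod_cast hℓv) (by exact_mod_cast hplℓ)
        · exact eq_of_natCast_mem_of_mod_four_eq_three hℓ h3 hℓv hplℓ
      exact hv (Finset.mem_image.mpr ⟨⟨ℓ, hℓmn⟩, Finset.mem_univ _, hv'.symm⟩)
    exact ⟨fun h ↦ key m (dvd_mul_right m n) h, fun h ↦ key n (dvd_mul_left n m) h⟩

/-! ## §3 The box over `ℚ(i)` and the conclusions -/

/-- Transport of the Mordell–Weil rank along an equality of curves. [folklore] -/
private theorem mordellWeilRank_congr {F : Type} [Field F] [NumberField F] {V V' : WeierstrassCurve F}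
    [V.IsElliptic] [V'.IsElliptic] (e : V = V') : V.mordellWeilRank = V'.mordellWeilRank := by
  subst e; rfl

/-- Transport of `t_p` along an equality of curves. [folklore] -/
private theorem shaCorank_congr {F : Type} [Field F] [NumberField F] {V V' : WeierstrassCurve F}
    [V.IsElliptic] [V'.IsElliptic] (e : V = V') (p : ℕ) [Fact p.Prime] : V.shaCorank p = V'.shaCorank p := by
  subst e; rfl

/-- `[ℚ(ζ₄) : ℚ] = 2`. [folklore] -/
private theorem finrank_rat_four : Module.finrank ℚ K = 2 := by
  rw [IsCyclotomicExtension.finrank (n := 4) K (Polynomial.cyclotomic.irreducible_rat (by norm_num)),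
    show Nat.totient 4 = 2 by decide]

/-- **`rank E(ℚ(i)) = rank E(ℚ) + rank E^{(-4)}(ℚ)`** for `E = E_{m,n}` (tree `mordellWeilRank_baseChange_quadratic_holds` at
`K = ℚ(i)`, `d = -4`, transported to the model `E_{m,n}/ℚ(i)`). [cite: SilvermanAEC2009, Exercise 10.16] -/
theorem mordellWeilRank_base_eq_add [((kubertTateFive (m : ℚ) (n : ℚ)).quadraticTwist (-4)).IsElliptic] :
    haveI := isElliptic_base (K := K) m n
    (kubertTateFive (m : K) (n : K)).mordellWeilRank =
      (kubertTateFive (m : ℚ) (n : ℚ)).mordellWeilRank + ((kubertTateFive (m : ℚ) (n : ℚ)).quadraticTwist (-4)).mordellWeilRank := by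
  haveI := isElliptic_base (K := K) m n
  haveI : ((kubertTateFive (m : ℚ) (n : ℚ)).baseChange K).IsElliptic := by
    rw [KubertTateMuDescentNF.baseChange_eq (K := ℚ) m n K]; infer_instance
  have hd : ((NumberField.discr K : ℤ) : ℚ) ≠ 0 := by exact_mod_cast NumberField.discr_ne_zero K
  haveI : ((kubertTateFive (m : ℚ) (n : ℚ)).quadraticTwist (NumberField.discr K : ℚ)).IsElliptic :=
    isElliptic_quadraticTwist _ hd
  have hR := mordellWeilRank_baseChange_quadratic_holds (kubertTateFive (m : ℚ) (n : ℚ)) K finrank_rat_four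
  rw [mordellWeilRank_congr (KubertTateMuDescentNF.baseChange_eq (K := ℚ) m n K)] at hR
  have h4 : ((NumberField.discr K : ℤ) : ℚ) = -4 := by rw [discr_of_isCyclotomicExtension_four K]; norm_num
  rw [h4] at hR
  exact hR

/-- **The box over `ℚ(i)` is full** whenever `#S ≤ rank E(ℚ) + 1`: `5 ^ #S ≤ 5^{rank E(ℚ(i))} · #E(ℚ(i))[5]` (`rank E(ℚ(i)) ≥
rank E(ℚ)`, `T = (0,0)` of order `5`). [cite: SilvermanAEC2009, Thm. X.4.2 and Exercise 10.16] -/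
theorem box_full [((kubertTateFive (m : ℚ) (n : ℚ)).quadraticTwist (-4)).IsElliptic]
    (S : Finset (HeightOneSpectrum (𝓞 K))) (hS : S.card ≤ (kubertTateFive (m : ℚ) (n : ℚ)).mordellWeilRank + 1) :
    haveI := isElliptic_base (K := K) m n
    5 ^ S.card ≤ Nat.card ((kubertTateFive (m : K) (n : K)).toAffine.Point ⧸ (nsmulAddMonoidHom (5 : ℕ) :
      (kubertTateFive (m : K) (n : K)).toAffine.Point →+ (kubertTateFive (m : K) (n : K)).toAffine.Point).range) := by
  haveI := isElliptic_base (K := K) m n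
  set E := kubertTateFive (m : K) (n : K) with hEdef
  haveI : Module.Finite ℤ E.toAffine.Point := by convert module_finite_point_holds E
  rw [natCard_quotient_nsmulRange_eq E.toAffine.Point 5]
  obtain ⟨hm0, hn0, -⟩ := ne_zero_of_isElliptic (m : K) (n : K)
  obtain ⟨T, hT⟩ := exists_addOrderOf_eq_five_kubertTateFive hm0 hn0
  have h5T : 5 ≤ Nat.card (AddSubgroup.torsionBy E.toAffine.Point ((5 : ℕ) : ℤ)) := by
    haveI : Finite (AddSubgroup.torsionBy E.toAffine.Point ((5 : ℕ) : ℤ)) :=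
      Literature.NumberTheory.EllipticCurves.finite_torsionBy_of_injective
        (toGeomPoints E) (toGeomPoints_injective _) _
        (WeierstrassCurve.finite_torsionBy_of_isAlgClosed (V := E.baseChange (AlgebraicClosure K)) (by norm_num))
    have hsub : AddSubgroup.zmultiples T ≤ AddSubgroup.torsionBy _ ((5 : ℕ) : ℤ) := by
      rw [AddSubgroup.zmultiples_le, mem_torsionBy_iff, natCast_zsmul, ← hT, addOrderOf_nsmul_eq_zero]
    have := AddSubgroup.card_le_of_le hsub
    rwa [Nat.card_zmultiples, hT] at this
  have hr : Module.finrank ℤ E.toAffine.Point = E.mordellWeilRank := by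
    unfold WeierstrassCurve.mordellWeilRank; congr!
  have hRK := mordellWeilRank_base_eq_add (K := K) m n
  rw [← hEdef] at hRK
  have hle : S.card ≤ Module.finrank ℤ E.toAffine.Point + 1 := by rw [hr]; omega
  calc 5 ^ S.card ≤ 5 ^ (Module.finrank ℤ E.toAffine.Point + 1) := Nat.pow_le_pow_right (by norm_num) hle
    _ = 5 ^ Module.finrank ℤ E.toAffine.Point * 5 := by rw [pow_succ]
    _ ≤ 5 ^ Module.finrank ℤ E.toAffine.Point * Nat.card (AddSubgroup.torsionBy E.toAffine.Point ((5 : ℕ) : ℤ)) :=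
        Nat.mul_le_mul_left _ h5T

section Main

variable (h5 : ¬ (5 : ℤ) ∣ (kubertTateFive m n).Δ)
  (hbad : ∀ ℓ : ℕ, ℓ.Prime → (ℓ : ℤ) ∣ (kubertTateFive m n).Δ → ℓ % 5 ≠ 1 ∧ (ℓ % 5 = 4 → ℓ % 4 = 1))
  (hω : ∀ ℓ ∈ (m * n).natAbs.primeFactors, ℓ = 2 ∨ ℓ % 4 = 3)
  {x y : ℚ} (hxy : (kubertTateFive (m : ℚ) (n : ℚ)).toAffine.Nonsingular x y) (hx0 : x ≠ 0) (hx : x ≠ m * n)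
  (q : ℕ) [Fact q.Prime] (hq5 : q ≠ 5) (hq11 : 2 * q + 1 < 25) (hqΔ : ¬ (q : ℤ) ∣ (kubertTateFive m n).Δ)
  (hr : (m * n).natAbs.primeFactors.card ≤ (kubertTateFive (m : ℚ) (n : ℚ)).mordellWeilRank + 1)
  [htw : ((kubertTateFive (m : ℚ) (n : ℚ)).quadraticTwist (-4)).IsElliptic]

include h5 hbad hω hxy hx0 hx hq5 hq11 hqΔ hr in
/-- **`t₅(E_{m,n} ⊗ ℚ(i)) = 0`** in the Gaussian-tame régime with full `ℚ`-box and no prime factor of `mn` `≡ 1 (mod 4)`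
(descent over `ℚ(i)`, tree `KubertTateMuDescentNF.shaCorank_five_eq_zero_of_le`). [cite: SilvermanAEC2009, Thm. X.4.2(a)]
[cite: Fisher2001FiveSevenDescent, §2] -/
theorem shaCorank_five_baseChange_eq_zero :
    haveI := isElliptic_base (K := K) m n
    (kubertTateFive (m : K) (n : K)).shaCorank 5 = 0 := by
  haveI := isElliptic_base (K := K) m n
  obtain ⟨hm0, hn0, -⟩ := ne_zero_of_isElliptic (m : ℚ) (n : ℚ)
  have hm : m ≠ 0 := by exact_mod_cast hm0
  have hn : n ≠ 0 := by exact_mod_cast hn0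
  obtain ⟨S, hScard, hS⟩ := exists_support (K := K) m n hm hn hω
  exact KubertTateMuDescentNF.shaCorank_five_eq_zero_of_le m n _ (fun σ ↦ smul_toGeomPoints _ σ _)
    (twentyfive_zsmul_toGeomPoints_cast_ne_zero m n hxy hx0 hx q hq5 hq11 hqΔ) S hS h5 hbad
    (box_full m n S (hScard.trans hr))

include h5 hbad hω hxy hx0 hx hq5 hq11 hqΔ hr in
/-- **`rank E_{m,n}(ℚ(i)) = rank E_{m,n}(ℚ)`** (and the `ℚ`-box is then exactly full: `ω(mn) = rank + 1`):
`rank_K + 1 ≤ #S ≤ ω(mn) ≤ rank_ℚ + 1 ≤ rank_K + 1`. [cite: SilvermanAEC2009, Thm. X.4.2 and Exercise 10.16] -/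
theorem mordellWeilRank_baseChange_eq :
    haveI := isElliptic_base (K := K) m n
    (kubertTateFive (m : K) (n : K)).mordellWeilRank = (kubertTateFive (m : ℚ) (n : ℚ)).mordellWeilRank ∧
      (m * n).natAbs.primeFactors.card = (kubertTateFive (m : ℚ) (n : ℚ)).mordellWeilRank + 1 := by
  haveI := isElliptic_base (K := K) m n
  obtain ⟨hm0, hn0, -⟩ := ne_zero_of_isElliptic (m : ℚ) (n : ℚ)
  have hm : m ≠ 0 := by exact_mod_cast hm0
  have hn : n ≠ 0 := by exact_mod_cast hn0
  obtain ⟨S, hScard, hS⟩ := exists_support (K := K) m n hm hn hω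
  obtain ⟨ψ, hψ⟩ := KubertTateMuDescentNF.exists_dual (K := K) m n
  have hle := KubertTateMuDescentNF.mordellWeilRank_succ_le m n ψ hψ _ (fun σ ↦ smul_toGeomPoints _ σ _)
    (twentyfive_zsmul_toGeomPoints_cast_ne_zero m n hxy hx0 hx q hq5 hq11 hqΔ) S hS h5 hbad
  have hRK := mordellWeilRank_base_eq_add (K := K) m n
  omega

include h5 hbad hω hxy hx0 hx hq5 hq11 hqΔ hr in
/-- **`rank E_{m,n}^{(-4)}(ℚ) = 0`, unconditionally** (the twist by `d_{ℚ(i)} = -4`, `≅` the twist by `-1`; no rational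
`5`-torsion). [cite: SilvermanAEC2009, Exercise 10.16] [cite: Fisher2001FiveSevenDescent, §2] -/
theorem mordellWeilRank_twist_eq_zero :
    ((kubertTateFive (m : ℚ) (n : ℚ)).quadraticTwist (-4)).mordellWeilRank = 0 := by
  haveI : IsCyclotomicExtension {4} ℚ (CyclotomicField 4 ℚ) := CyclotomicField.isCyclotomicExtension 4 ℚ
  have h := (mordellWeilRank_baseChange_eq (K := CyclotomicField 4 ℚ) m n h5 hbad hω hxy hx0 hx q hq5 hq11 hqΔ hr).1
  have hRK := mordellWeilRank_base_eq_add (K := CyclotomicField 4 ℚ) m n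
  omega

include h5 hbad hω hxy hx0 hx hq5 hq11 hqΔ hr in
/-- **`t₅(E_{m,n}^{(-4)}/ℚ) = 0` and `t₅(E_{m,n}/ℚ) = 0`, unconditionally**: `t₅(E_K) = t₅(E) + t₅(E^{(-4)})` at `K = ℚ(i)`
(`corank Sel(E_K) = corank Sel(E) + corank Sel(E^{(-4)})`, tree `selmerCorank_baseChange_quadratic_holds`, minus the rank
splitting and Greenberg's `corank Sel = rank + t`) with `t₅(E_K) = 0`. [cite: Dokchitser2013ParityNotes, §4]
[cite: SilvermanAEC2009, Thm. X.4.2] -/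
theorem shaCorank_five_twist_eq_zero_and :
    ((kubertTateFive (m : ℚ) (n : ℚ)).quadraticTwist (-4)).shaCorank 5 = 0 ∧
      (kubertTateFive (m : ℚ) (n : ℚ)).shaCorank 5 = 0 := by
  haveI : Fact (Nat.Prime 5) := ⟨Nat.prime_five⟩
  haveI : IsCyclotomicExtension {4} ℚ (CyclotomicField 4 ℚ) := CyclotomicField.isCyclotomicExtension 4 ℚ
  haveI := isElliptic_base (K := CyclotomicField 4 ℚ) m n
  haveI hbc : ((kubertTateFive (m : ℚ) (n : ℚ)).baseChange (CyclotomicField 4 ℚ)).IsElliptic := by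
    rw [KubertTateMuDescentNF.baseChange_eq (K := ℚ) m n (CyclotomicField 4 ℚ)]; infer_instance
  have hd : ((NumberField.discr (CyclotomicField 4 ℚ) : ℤ) : ℚ) ≠ 0 := by
    exact_mod_cast NumberField.discr_ne_zero (CyclotomicField 4 ℚ)
  haveI : ((kubertTateFive (m : ℚ) (n : ℚ)).quadraticTwist (NumberField.discr (CyclotomicField 4 ℚ) : ℚ)).IsElliptic :=
    isElliptic_quadraticTwist _ hd
  have hS := selmerCorank_baseChange_quadratic_holds (kubertTateFive (m : ℚ) (n : ℚ)) (CyclotomicField 4 ℚ)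
    finrank_rat_four 5
  have hR := mordellWeilRank_baseChange_quadratic_holds (kubertTateFive (m : ℚ) (n : ℚ)) (CyclotomicField 4 ℚ)
    finrank_rat_four
  have hK := ((kubertTateFive (m : ℚ) (n : ℚ)).baseChange (CyclotomicField 4 ℚ)).selmerCorank_eq_mordellWeilRank_add_holds 5
  have hQ := (kubertTateFive (m : ℚ) (n : ℚ)).selmerCorank_eq_mordellWeilRank_add_holds 5
  have hT := ((kubertTateFive (m : ℚ) (n : ℚ)).quadraticTwist
    (NumberField.discr (CyclotomicField 4 ℚ) : ℚ)).selmerCorank_eq_mordellWeilRank_add_holds 5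
  have h0 : ((kubertTateFive (m : ℚ) (n : ℚ)).baseChange (CyclotomicField 4 ℚ)).shaCorank 5 = 0 := by
    rw [shaCorank_congr (KubertTateMuDescentNF.baseChange_eq (K := ℚ) m n (CyclotomicField 4 ℚ)) 5]
    exact shaCorank_five_baseChange_eq_zero (K := CyclotomicField 4 ℚ) m n h5 hbad hω hxy hx0 hx q hq5 hq11 hqΔ hr
  have h4 : ((NumberField.discr (CyclotomicField 4 ℚ) : ℤ) : ℚ) = -4 := by
    rw [discr_cyclotomicField_four]; norm_num
  rw [h4] at hS hR hT
  omega

end Main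

/-! ## §4 The instance `(m, n) = (28, 9)`: `E_{28/9} = [-19, -252, -2268, 0, 0]`, rank `2` -/

/-- **Gaussian tameness of `E_{28/9}`**: bad primes `2, 3, 7, 2069`; `2069 ≡ 4 (mod 5)` is `≡ 1 (mod 4)`.
[cite: Fisher2001FiveSevenDescent, §2] -/
theorem gaussian_tame_28_9 : ∀ ℓ : ℕ, ℓ.Prime → (ℓ : ℤ) ∣ (kubertTateFive (28 : ℤ) 9).Δ →
    ℓ % 5 ≠ 1 ∧ (ℓ % 5 = 4 → ℓ % 4 = 1) := by
  intro p hp hdvd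
  refine ⟨KubertTate289Descent.tame p hp hdvd, fun h4 ↦ ?_⟩
  rw [KubertTate289Descent.Δ_int] at hdvd
  have hdvdN : p ∣ 2 ^ 10 * 3 ^ 10 * 7 ^ 5 * 2069 := by
    have h' : (p : ℤ) ∣ ((2 ^ 10 * 3 ^ 10 * 7 ^ 5 * 2069 : ℕ) : ℤ) := by
      have e : ((2 ^ 10 * 3 ^ 10 * 7 ^ 5 * 2069 : ℕ) : ℤ) = 2102631636446208 := by norm_num
      rw [e]; exact (Int.dvd_neg.mpr hdvd)
    exact Int.natCast_dvd_natCast.mp h'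
  have hpi := Nat.Prime.prime hp
  rcases hpi.dvd_or_dvd hdvdN with h | h
  · rcases hpi.dvd_or_dvd h with h | h
    · rcases hpi.dvd_or_dvd h with h | h
      · have := (Nat.prime_dvd_prime_iff_eq hp Nat.prime_two).mp (hpi.dvd_of_dvd_pow h); omega
      · have := (Nat.prime_dvd_prime_iff_eq hp Nat.prime_three).mp (hpi.dvd_of_dvd_pow h); omega
    · have := (Nat.prime_dvd_prime_iff_eq hp (by norm_num : Nat.Prime 7)).mp (hpi.dvd_of_dvd_pow h); omega
  · have := (Nat.prime_dvd_prime_iff_eq hp (by norm_num : Nat.Prime 2069)).mp h; omega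

/-- The prime factors of `mn = 252 = 2²·3²·7` are `2` or `≡ 3 (mod 4)`. [folklore] -/
private theorem primeFactors_28_9 : ∀ ℓ ∈ ((28 : ℤ) * 9).natAbs.primeFactors, ℓ = 2 ∨ ℓ % 4 = 3 := by
  intro ℓ hℓ
  have e : ((28 : ℤ) * 9).natAbs = 2 ^ 2 * 3 ^ 2 * 7 := by norm_num
  rw [e, Nat.mem_primeFactors] at hℓ
  obtain ⟨hp, hdvd, -⟩ := hℓ
  have hpi := Nat.Prime.prime hp
  rcases hpi.dvd_or_dvd hdvd with h | h
  · rcases hpi.dvd_or_dvd h with h | h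
    · exact Or.inl ((Nat.prime_dvd_prime_iff_eq hp Nat.prime_two).mp (hpi.dvd_of_dvd_pow h))
    · have := (Nat.prime_dvd_prime_iff_eq hp Nat.prime_three).mp (hpi.dvd_of_dvd_pow h); omega
  · have := (Nat.prime_dvd_prime_iff_eq hp (by norm_num : Nat.Prime 7)).mp h; omega

/-- `ω(252) = 3`. [folklore] -/
private theorem card_primeFactors_28_9 : ((28 : ℤ) * 9).natAbs.primeFactors.card = 3 := by
  have e : ((28 : ℤ) * 9).natAbs = 2 ^ 2 * 3 ^ 2 * 7 := by norm_num
  rw [e, Nat.primeFactors_mul (by norm_num) (by norm_num), Nat.primeFactors_mul (by norm_num) (by norm_num),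
    Nat.primeFactors_prime_pow (by norm_num) Nat.prime_two, Nat.primeFactors_prime_pow (by norm_num) Nat.prime_three,
    Nat.Prime.primeFactors (by norm_num : Nat.Prime 7)]
  decide

/-- **`E_{28/9}^{(-4)}/ℚ` has rank `0` and `t₅ = 0`, unconditionally** (`E_{28/9}`: rank `2`, box full, tree
`KubertTate289Descent`; descent over `ℚ(i)` with `K = CyclotomicField 4 ℚ`; reference point `(-36, 1296)`, good prime `11`).
[cite: SilvermanAEC2009, Thm. X.4.2 and Exercise 10.16] [cite: Fisher2001FiveSevenDescent, §2] -/
theorem twist_28_9 :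
    haveI := KubertTate289Descent.isElliptic
    ∀ [((kubertTateFive (((28 : ℤ) : ℚ)) (((9 : ℤ) : ℚ))).quadraticTwist (-4)).IsElliptic],
      ((kubertTateFive (((28 : ℤ) : ℚ)) (((9 : ℤ) : ℚ))).quadraticTwist (-4)).mordellWeilRank = 0 ∧
        ((kubertTateFive (((28 : ℤ) : ℚ)) (((9 : ℤ) : ℚ))).quadraticTwist (-4)).shaCorank 5 = 0 := by
  haveI := KubertTate289Descent.isElliptic
  intro htw
  haveI : Fact (Nat.Prime 11) := ⟨by norm_num⟩
  have hP : (kubertTateFive (((28 : ℤ) : ℚ)) (((9 : ℤ) : ℚ))).toAffine.Nonsingular (-36) 1296 :=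
    (KubertTate289Descent.nonsingular_iff _ _).mpr (by norm_num)
  have hr : ((28 : ℤ) * 9).natAbs.primeFactors.card ≤
      (kubertTateFive (((28 : ℤ) : ℚ)) (((9 : ℤ) : ℚ))).mordellWeilRank + 1 := by
    rw [card_primeFactors_28_9, KubertTate289Descent.mordellWeilRank_eq]
  exact ⟨mordellWeilRank_twist_eq_zero 28 9 KubertTate289Descent.not_five_dvd_Δ
      gaussian_tame_28_9 primeFactors_28_9 hP (by norm_num) (by norm_num) 11 (by norm_num) (by norm_num)
      KubertTate289Descent.not_tor_dvd_Δ hr,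
    (shaCorank_five_twist_eq_zero_and 28 9 KubertTate289Descent.not_five_dvd_Δ
      gaussian_tame_28_9 primeFactors_28_9 hP (by norm_num) (by norm_num) 11 (by norm_num) (by norm_num)
      KubertTate289Descent.not_tor_dvd_Δ hr).1⟩

end KubertTateGaussianTwist

end Literature.NumberTheory.EllipticCurves

end
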